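import Literature.MathematicalPhysics.QuantumLattice.HubbardGridFieldSubstitution
import Literature.MathematicalPhysics.QuantumLattice.HubbardUVSymbolCTDifferences
import Literature.MathematicalPhysics.QuantumLattice.HubbardUVSymbolJets
import Literature.Probability.LatticeModels.SampledSmoothSymbolPeriodisation
import Summits.HubbardSuperconductivity.HubbardSuperconductivity.Theorems.KLProgrammeC4aLatticeTubeSum
import Summits.HubbardSuperconductivity.HubbardSuperconductivity.Theorems.KLProgrammeKLRegimeEngineScaleZeroDecay
import Summits.HubbardSuperconductivity.HubbardSuperconductivity.Theorems.KLProgrammeKLRegimeEngineFrameLevelCount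

/-!
# Route `KLProgramme`, crux K3 — engine-flow child (stmt-HubbardSuperconductivity-20437), stub (C) at `n = 0`, located item #22a «(C)-SCALE0-PT2»,
# L-layer §2a (L): the scale-`0` covariance `Sᵀ C^K_{>Λ} S` IS, frequency by frequency, the PERIODISATION of the infinite-lattice kernel of the
# sampled UV symbol — exact identity + the torus-comparison clause with an explicit rate, in the engine's own vocabulary

Cell gate-hubbard-kl, seat p1 g19 (supplier of #22a's L-layer; this is the INSTANCE of the generic
`Literature.Probability.LatticeModels.SampledSmoothSymbolPeriodisation` / `Literature.MathematicalPhysics.QuantumLattice.HubbardFreePropagatorPeriodization`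
§Sampling for the cutoff covariance of the K3 engine).  Objects (all from the tree): the pulled-back normal covariance
`(gridSubMatrix L M β x τ)ᵀ · normalCovariance (uvSymbolCT L M β μ K Λ) · gridSubMatrix L M β x τ` of `HubbardGridFieldSubstitution`
(its `(+,−)` entry `= [σ=σ']·(βL²)⁻² Σ_{(i,k⃗)} e^{i(k·x_a − k·x_b)}·Ψ`, `gridSub_pullback_normalCovariance_apply_zero_one`), the UV symbol
`uvSymbolFn (βL²) Λ e ω` with `uvSymbolCT_eq_uvSymbolFn`, the frame band `nambuXiCT L μ K k⃗ = ctBandFn μ K (2πk⃗/L) = frameLevel μ K (toLp (2πk⃗/L))`.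
The SPATIAL SYMBOL OF FREQUENCY `ω` (no definition is introduced; it is the lambda)
`g_ω(y) := uvSymbolFn (βL²) Λ (frameLevel μ K ((2π) • y)) ω`, `y ∈ Momentum = EuclideanSpace ℝ (Fin 2)` — `ℤ²`-periodic and `C^∞` for `ω ≠ 0`.

* §1 `uvSpatialSymbol_isLatticePeriodic`, `uvSpatialSymbol_contDiff`, `uvSpatialSymbol_sample` — periodicity, smoothness, and
  `g_ω(k⃗/L) = Ψ(ω, e_K(k⃗))` at the torus momenta;
* §2 **`gridCov_uvSymbolCT_apply_zero_one_eq_sum_freq`** — the `(+,−)` entry of `Sᵀ C^K_{>Λ} S` between the grid points `a, b` equals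
  `[σ=σ']·Σ_i (βL²)⁻²·e^{iω_i(τ_a−τ_b)}·(L² · torusFourierInv (k⃗ ↦ g_{ω_i}(k⃗/L)) (z̄))`, `z_j = val(x_a)_j − val(x_b)_j ∈ ℤ` (spin-diagonal;
  the spatial factor is EXACTLY the momentum sum of the sampled symbol of `SampledSmoothSymbolPeriodisation`);
* §3 **`torusFourierInv_uvSpatialSample_eq_tsum_images`** — hence, for every frequency, the spatial factor is the SUM OVER IMAGES
  `Σ_{n ∈ ℤ²} a_{ω}(z + Ln)`, `a_ω(x⃗) = 𝓕(g_ω♭)(−x⃗)` the infinite-lattice kernel (BGM (2.4) «in the limit `L → ∞`»), unconditionally;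
  **`norm_torusFourierInv_uvSpatialSample_sub_kernel_le`** — and the TORUS-COMPARISON CLAUSE with a number:
  `‖L⁻²Σ_{k⃗} χ_{k⃗}(z̄)Ψ(ω, e_K(k⃗)) − a_ω(z)‖ ≤ D/(2π)^N·(2/(2R+2))^{N−4}·2²·C₂` for EVERY `L ≥ R+1+|z|₁`, given the momentum-jet bound
  `‖D^N g_ω‖ ≤ D` (`N ≥ 4`; supplied per frequency from the tree's symbol jets `HubbardUVSymbolJets*` × band jets — a hypothesis here);
  `norm_torusFourierInv_uvSpatialSample_le_inv_pow` — the `L`-UNIFORM decay `≤ max(D₀, D/π^N)(1+4^N S_N)(1+‖z‖_∞)^{−N}` at centred sites.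

Proofs only; no definitions; nothing here asserts (C), any stub of 20437, K3 or superconductivity.  References: BGM 2006 §2.1 (2.3)–(2.4), §2.2 footnote 1
[cite: BenfattoGiulianiMastropietro2006]; Glimm–Jaffe 1987 Prop. 7.3.1 [cite: GlimmJaffeQP1987].
-/

noncomputable section

namespace Summit.HubbardSuperconductivity.HubbardSuperconductivity.Theorems.KLRegimeSplit

set_option linter.dupNamespace false -- summit = problem name (single-conjunct summit), D-0017

open Literature.MathematicalPhysics.QuantumLattice Literature.Probability.LatticeModels Literature.Analysis.FunctionSpaces
open Summit.HubbardSuperconductivity.HubbardSuperconductivity.Theorems.DispersionFlow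
open Summit.HubbardSuperconductivity.HubbardSuperconductivity.Theorems.C4a
open Summit.HubbardSuperconductivity.HubbardSuperconductivity.Theorems.EngineV8 (contDiff_frameLevel)
open Summit.HubbardSuperconductivity.HubbardSuperconductivity.Theorems.ScaleZeroDecay (frameLevel_toLp_eq_ctBandFn)
open Finset Complex UnitAddTorus Real
open scoped ContDiff

variable {L M : ℕ} [NeZero L]

/-! ## §1 The spatial symbol of one frequency: periodicity, smoothness, samples -/

/-- **Periodicity**: `y ↦ Ψ(ω, e_K(2πy))` is `ℤ²`-periodic on the momentum plane (the frame band is `2π`-periodic). -/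
theorem uvSpatialSymbol_isLatticePeriodic (c Λ μ : ℝ) (K : TrigPolyC4v) (om : ℝ) :
    Torus.IsLatticePeriodic (fun y : Momentum => uvSymbolFn c Λ (frameLevel μ K ((2 * π) • y)) om) :=
  isLatticePeriodic_rescale (Φ := fun q : Momentum => uvSymbolFn c Λ (frameLevel μ K q) om)
    (fun j q => by simp only [frameLevel_periodic_single])

/-- **Smoothness**: `y ↦ Ψ(ω, e_K(2πy))` is `C^∞` on the momentum plane for `ω ≠ 0` (`contDiff_uvSymbolFnXi` ∘ `contDiff_frameLevel`). -/
theorem uvSpatialSymbol_contDiff (c : ℝ) {Λ : ℝ} (μ : ℝ) (K : TrigPolyC4v) {om : ℝ} (hom : om ≠ 0) :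
    ContDiff ℝ (⊤ : ℕ∞) (fun y : Momentum => uvSymbolFn c Λ (frameLevel μ K ((2 * π) • y)) om) := by
  have h1 : ContDiff ℝ (⊤ : ℕ∞) (fun e : ℝ => uvSymbolFn c Λ e om) := by
    have : (fun e : ℝ => uvSymbolFn c Λ e om) = uvSymbolFnXi c Λ om := funext fun e => uvSymbolFn_eq_uvSymbolFnXi c Λ e om
    rw [this]
    exact contDiff_uvSymbolFnXi hom
  exact h1.comp ((contDiff_frameLevel μ K).comp (contDiff_const_smul (2 * π)))

/-- **Samples**: at the torus momentum `k⃗`, `g_ω(k⃗/L) = Ψ(ω, e_K(k⃗))` (`e_K(k⃗) = nambuXiCT L μ K k⃗`). -/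
theorem uvSpatialSymbol_sample (c Λ μ : ℝ) (K : TrigPolyC4v) (om : ℝ) (k : TorusSite 2 L) :
    (fun y : Momentum => uvSymbolFn c Λ (frameLevel μ K ((2 * π) • y)) om) (WithLp.toLp 2 fun i => ((k i).val : ℝ) / L) =
      uvSymbolFn c Λ (nambuXiCT L μ K k) om := by
  simp only []
  rw [← toLp_latticeMomentum_eq_smul, frameLevel_toLp_eq_ctBandFn, ← nambuXiCT_eq_ctBandFn]

/-! ## §2 The scale-`0` covariance entry, frequency by frequency, as momentum sums of the sampled spatial symbol -/

/-- The space–time phase difference of two grid points splits into the frequency part and the spatial character: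
`e^{i(k·X_a − k·X_b)} = e^{iω(τ_a − τ_b)}·χ_{k⃗}(z̄)`, `z_j = val(x_a)_j − val(x_b)_j`. -/
theorem cexp_vertexPhase_sub_eq (β : ℝ) (k : FreqMomentum L M) (xa xb : TorusSite 2 L) (τa τb : ℝ) :
    cexp (((vertexPhase L M β k xa τa - vertexPhase L M β k xb τb : ℝ) : ℂ) * I) =
      cexp (I * (((matsubaraFreq β M k.1 * (τa - τb) : ℝ)) : ℂ)) *
        torusChar k.2 (Torus.proj L fun j => ((xa j).val : ℤ) - (xb j).val) := by
  rw [torusChar_proj, ← Complex.exp_add]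
  congr 1
  simp only [vertexPhase]
  push_cast
  simp only [mul_sub, Finset.sum_sub_distrib]
  ring

/-- **The `(+,−)` entry of the scale-`0` covariance `Sᵀ C^K_{>Λ} S`, frequency by frequency**: for `0 < β`,
`(SᵀCS)((a,σ,+),(b,σ',−)) = [σ=σ']·Σ_i (βL²)⁻²·e^{iω_i(τ_a−τ_b)}·Σ_{k⃗} χ_{k⃗}(z̄)·Ψ(ω_i, e_K(k⃗))`, `z = val(x_a) − val(x_b)`. -/
theorem gridCov_uvSymbolCT_apply_zero_one_eq_sum_freq {P : Type*} [Fintype P] [DecidableEq P] {β : ℝ} (hβ : 0 < β) (μ : ℝ)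
    (K : TrigPolyC4v) (Λ : ℝ) (x : P → TorusSite 2 L) (τ : P → ℝ) (a b : P) (σ σ' : Fin 2) :
    ((gridSubMatrix L M β x τ).transpose * normalCovariance L M (uvSymbolCT L M β μ K Λ) * gridSubMatrix L M β x τ) ((a, σ), 0) ((b, σ'), 1) =
      if σ = σ' then ∑ i : MatsubaraIdx M, ((1 / (β * (L : ℝ) ^ 2) : ℝ) : ℂ) ^ 2 *
        cexp (I * (((matsubaraFreq β M i * (τ a - τ b) : ℝ)) : ℂ)) *
          ∑ kv : TorusSite 2 L, torusChar kv (Torus.proj L fun j => ((x a j).val : ℤ) - (x b j).val) *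
            uvSymbolFn (β * (L : ℝ) ^ 2) Λ (nambuXiCT L μ K kv) (matsubaraFreq β M i) else 0 := by
  rw [gridSub_pullback_normalCovariance_apply_zero_one]
  split_ifs with h
  · rw [Fintype.sum_prod_type]
    refine Finset.sum_congr rfl fun i _ => ?_
    rw [Finset.mul_sum]
    refine Finset.sum_congr rfl fun kv _ => ?_
    rw [cexp_vertexPhase_sub_eq, uvSymbolCT_eq_uvSymbolFn hβ]
    ring
  · rfl

/-- **The spatial factor is the momentum sum of the SAMPLED spatial symbol** (the object of `SampledSmoothSymbolPeriodisation`):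
`Σ_{k⃗} χ_{k⃗}(z̄)·Ψ(ω, e_K(k⃗)) = L²·torusFourierInv (k⃗ ↦ g_ω(k⃗/L)) (z̄)`. -/
theorem sum_torusChar_mul_uvSymbol_eq_torusFourierInv (c Λ μ : ℝ) (K : TrigPolyC4v) (om : ℝ) (z : Site 2) :
    ∑ kv : TorusSite 2 L, torusChar kv (Torus.proj L z) * uvSymbolFn c Λ (nambuXiCT L μ K kv) om =
      ((L : ℂ) ^ 2) * torusFourierInv (fun kv : TorusSite 2 L =>
        (fun y : Momentum => uvSymbolFn c Λ (frameLevel μ K ((2 * π) • y)) om) (WithLp.toLp 2 fun i => ((kv i).val : ℝ) / L))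
          (Torus.proj L z) := by
  have hL : ((L : ℂ) ^ 2) ≠ 0 := pow_ne_zero 2 (Nat.cast_ne_zero.2 (NeZero.ne L))
  rw [torusFourierInv_eq_sum_torusChar, ← mul_assoc, mul_inv_cancel₀ hL, one_mul]
  refine Finset.sum_congr rfl fun kv _ => ?_
  rw [uvSpatialSymbol_sample, mul_comm]

/-! ## §3 Periodisation and the torus-comparison clause for the scale-`0` covariance, per frequency -/

/-- **The scale-`0` covariance is the periodisation of the infinite-lattice kernel, frequency by frequency** (exact, every `L ≥ 1`):
for `ω ≠ 0`, `L⁻²·Σ_{k⃗} χ_{k⃗}(z̄)·Ψ(ω, e_K(k⃗)) = Σ_{n ∈ ℤ²} a_ω(z + Ln)`, `a_ω(x⃗) := 𝓕(g_ω♭)(−x⃗)`, `g_ω♭ = Torus.descend g_ω`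
(Glimm–Jaffe Prop. 7.3.1 / BGM (2.4) for the CUTOFF covariance). -/
theorem torusFourierInv_uvSpatialSample_eq_tsum_images (c : ℝ) {Λ : ℝ} (μ : ℝ) (K : TrigPolyC4v) {om : ℝ} (hom : om ≠ 0) (z : Site 2) :
    torusFourierInv (fun kv : TorusSite 2 L =>
        (fun y : Momentum => uvSymbolFn c Λ (frameLevel μ K ((2 * π) • y)) om) (WithLp.toLp 2 fun i => ((kv i).val : ℝ) / L))
        (Torus.proj L z) =
      ∑' n : Site 2, mFourierCoeff (Torus.descend (fun y : Momentum => uvSymbolFn c Λ (frameLevel μ K ((2 * π) • y)) om)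
        (uvSpatialSymbol_isLatticePeriodic c Λ μ K om)) (-(z + (L : ℤ) • n)) :=
  torusFourierInv_smoothSample_eq_tsum (uvSpatialSymbol_isLatticePeriodic c Λ μ K om) (uvSpatialSymbol_contDiff c μ K hom) z

/-- **Torus-comparison clause for the scale-`0` covariance, per frequency, with a number**: if the momentum jets of the spatial symbol obey
`‖D^N g_ω(y)‖ ≤ D` for all `y` (`N ≥ 4`; supplied from the symbol × band jet tables), then for every box radius `R` and EVERY `L ≥ R + 1 + Σ_j|z_j|`:
`‖L⁻²·Σ_{k⃗} χ_{k⃗}(z̄)·Ψ(ω, e_K(k⃗)) − a_ω(z)‖ ≤ D/(2π)^N·(2/(2R+2))^{N−4}·(2²·Σ_{k∈ℤ²} ∏_j (1+k_j²)⁻¹)`. -/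
theorem norm_torusFourierInv_uvSpatialSample_sub_kernel_le (c : ℝ) {Λ : ℝ} (μ : ℝ) (K : TrigPolyC4v) {om : ℝ} (hom : om ≠ 0)
    {N : ℕ} (hN : 2 * 2 ≤ N) {D : ℝ}
    (hD : ∀ y : Momentum, ‖iteratedFDeriv ℝ N (fun y : Momentum => uvSymbolFn c Λ (frameLevel μ K ((2 * π) • y)) om) y‖ ≤ D)
    {R : ℕ} (z : Site 2) (hR : (R : ℤ) + 1 + ∑ i, |z i| ≤ L) :
    ‖torusFourierInv (fun kv : TorusSite 2 L =>
          (fun y : Momentum => uvSymbolFn c Λ (frameLevel μ K ((2 * π) • y)) om) (WithLp.toLp 2 fun i => ((kv i).val : ℝ) / L))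
          (Torus.proj L z) -
        mFourierCoeff (Torus.descend (fun y : Momentum => uvSymbolFn c Λ (frameLevel μ K ((2 * π) • y)) om)
          (uvSpatialSymbol_isLatticePeriodic c Λ μ K om)) (-z)‖ ≤
      D / (2 * Real.pi) ^ N * (2 / ((2 * R + 2 : ℕ) : ℝ)) ^ (N - 2 * 2) * (2 ^ 2 * ∑' k : Site 2, ∏ j, (1 + (k j : ℝ) ^ 2)⁻¹) :=
  norm_torusFourierInv_smoothSample_sub_le_of_iteratedFDeriv (uvSpatialSymbol_isLatticePeriodic c Λ μ K om)
    (uvSpatialSymbol_contDiff c μ K hom) hN hD z hR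

/-- **L-uniform decay of the scale-`0` covariance's spatial factor, per frequency**: if `‖g_ω‖ ≤ D₀` and `‖D^N g_ω‖ ≤ D` (`N ≥ 4`), then for every
`L ≥ 1` and every CENTRED `z` (`2‖z‖_∞ ≤ L`): `‖L⁻²·Σ_{k⃗} χ_{k⃗}(z̄)·Ψ(ω, e_K(k⃗))‖ ≤ max(D₀, D/π^N)·(1 + 4^N·Σ_n (1+‖n‖_∞)^{−N})·(1+‖z‖_∞)^{−N}`. -/
theorem norm_torusFourierInv_uvSpatialSample_le_inv_pow (c : ℝ) {Λ : ℝ} (μ : ℝ) (K : TrigPolyC4v) {om : ℝ} (hom : om ≠ 0)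
    {N : ℕ} (hN : 2 * 2 ≤ N) {D₀ D : ℝ}
    (h0 : ∀ y : Momentum, ‖(fun y : Momentum => uvSymbolFn c Λ (frameLevel μ K ((2 * π) • y)) om) y‖ ≤ D₀)
    (hD : ∀ y : Momentum, ‖iteratedFDeriv ℝ N (fun y : Momentum => uvSymbolFn c Λ (frameLevel μ K ((2 * π) • y)) om) y‖ ≤ D)
    {z : Site 2} (hz : 2 * ‖z‖ ≤ L) :
    ‖torusFourierInv (fun kv : TorusSite 2 L =>
          (fun y : Momentum => uvSymbolFn c Λ (frameLevel μ K ((2 * π) • y)) om) (WithLp.toLp 2 fun i => ((kv i).val : ℝ) / L))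
          (Torus.proj L z)‖ ≤
      max D₀ (D / Real.pi ^ N) * (1 + (4 : ℝ) ^ N * ∑' n : Site 2, ((1 + ‖n‖) ^ N)⁻¹) * ((1 + ‖z‖) ^ N)⁻¹ :=
  norm_torusFourierInv_smoothSample_le_inv_pow (uvSpatialSymbol_isLatticePeriodic c Λ μ K om)
    (uvSpatialSymbol_contDiff c μ K hom) hN h0 hD hz

/-- Matsubara frequencies are nonzero (`|ω_i| ≥ π/β > 0`), so §3 applies to every frequency of the scale-`0` covariance. -/
theorem matsubaraFreq_ne_zero' {β : ℝ} (hβ : 0 < β) (i : MatsubaraIdx M) : matsubaraFreq β M i ≠ 0 := by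
  intro h
  have h1 := pi_div_le_abs_matsubaraFreq (M := M) hβ i
  rw [h, abs_zero] at h1
  exact absurd h1 (not_le.2 (by positivity))

/-! ## §4 (append) Off-site: only the derivative constant — the frequency-summable shape -/

/-- **Off-site L-uniform decay of the scale-`0` covariance's spatial factor, per frequency, from the momentum jets ALONE**: for `ω ≠ 0`,
`‖D^N g_ω‖ ≤ D` (`N ≥ 4`), every `L ≥ 1` and every CENTRED off-site `z` (`2‖z‖_∞ ≤ L`, `z̄ ≠ 0`):
`‖L⁻²·Σ_{k⃗} χ_{k⃗}(z̄)·Ψ(ω, e_K(k⃗))‖ ≤ (D/π^N)·(1 + 4^N·Σ_n (1+‖n‖_∞)^{−N})·(1+‖z‖_∞)^{−N}` — no `sup|Ψ|`: the momentum-independent part of the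
symbol (the `1/(−iω)` term responsible for the non-summable `1/ω` size) is invisible off site, so the constant here is the DERIVATIVE constant, of size
`O(1/ω²)` in the frequency — the shape that sums over the Matsubara frequencies (SPEC §2a (M)). -/
theorem norm_torusFourierInv_uvSpatialSample_le_inv_pow_offSite (c : ℝ) {Λ : ℝ} (μ : ℝ) (K : TrigPolyC4v) {om : ℝ} (hom : om ≠ 0)
    {N : ℕ} (hN : 2 * 2 ≤ N) {D : ℝ}
    (hD : ∀ y : Momentum, ‖iteratedFDeriv ℝ N (fun y : Momentum => uvSymbolFn c Λ (frameLevel μ K ((2 * π) • y)) om) y‖ ≤ D)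
    {z : Site 2} (hz : 2 * ‖z‖ ≤ L) (hz0 : Torus.proj L z ≠ 0) :
    ‖torusFourierInv (fun kv : TorusSite 2 L =>
          (fun y : Momentum => uvSymbolFn c Λ (frameLevel μ K ((2 * π) • y)) om) (WithLp.toLp 2 fun i => ((kv i).val : ℝ) / L))
          (Torus.proj L z)‖ ≤
      (D / Real.pi ^ N) * (1 + (4 : ℝ) ^ N * ∑' n : Site 2, ((1 + ‖n‖) ^ N)⁻¹) * ((1 + ‖z‖) ^ N)⁻¹ :=
  norm_torusFourierInv_smoothSample_le_inv_pow_offSite (uvSpatialSymbol_isLatticePeriodic c Λ μ K om)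
    (uvSpatialSymbol_contDiff c μ K hom) hN hD hz hz0

end Summit.HubbardSuperconductivity.HubbardSuperconductivity.Theorems.KLRegimeSplit

end
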